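import Summits.QuantumFields.YangMills.Theorems.LocalInsertionWindowTailOfConcentration
import HarnessLib

/-!
# Line «local_insertion» on crux `HistoryTailL` (stmt-QuantumFields-19936) — THE WINDOW TAIL STEP UNDER THE EXACT BOX-FIT CONDITIONS
# (engine (E3) by kernel at EVERY height whose K1 box fits, including the two top heights on unit tori with `F.m ≥ 3`)

Cell `ym3-torus` (YM ladder rung R3 = continuum SU(2) Yang–Mills on the three-torus — a RUNG, NOT the Clay problem: not d = 4, not
infinite volume, not a mass gap), width seat `ym-ust-19936-w3` gen 11, `--supports stmt-QuantumFields-19936 --as helper`.  THEOREMS ONLY,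
definition-free, ROUTE-INDEPENDENT (no `Theses` import).  HONEST FRAMING: a CONDITIONAL one-height step (hypotheses `hK1` = text of
`MesoscopicConcentrationL` at one `(F,γ,K)`, `hK2` = window-Lipschitz text at one plaquette, `hMed` = median at scale `g`; none in the tree);
nothing of `LocalInsertionL` (23607), 23608, the stubs of `Cruxes/HistoryTailL/Lines/local_insertion.lean`, the crux `HistoryTailL` or any summit
statement is proved.

WHY.  ✓`WindowTailOfConcentration.windowTail_step` carries the side conditions `j + 2 ≤ K`, `γ ≤ ½`, used only to FIT the K1 box of side
`17·L^j` into the torus (`2·17L^j ≤ 2L^{F.m+K}`) and below the confinement side (`17L^j ≤ β_K = L^K/γ`).  Item 23607 asks ALL heights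
`1 ≤ j ≤ K`; the two top heights are reachable by the same argument whenever the box fits, i.e. `3 ≤ F.m + K − j` and `17γ ≤ L^{K−j}`
(`boxFit_of_depth`, `boxBeta_of_coupling`) — on every unit torus with `F.m ≥ 3` at ALL heights (for `γ ≤ 1/17`); only the tiny tori
`F.m ∈ {1,2}` keep a top-height corner outside K1's text (there the «local» box is the whole torus).
* `boxFit_of_depth`, `boxBeta_of_coupling`: the two fit conditions from `3 ≤ F.m + K − j` resp. `17γ ≤ L^{K−j}`.
* ★★`windowTail_step_of_boxFit`: `hK1 ∧ hK2 ∧ hMed ⇒ Gibbs_K(G(a,j) ∩ {n·g ≤ dist1(Ū^j(∂a))}) ≤ Cc·exp(−(cc/(1156(CL+1)²))·n²)` for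
  `n ≥ 2(m + (CL+1)√(578Cc/cc))`, at any `j ≤ K` under the two fit conditions (same proof as `windowTail_step`).
[cite: Balaban1985UV3, (3) p.256 and (7) p.257]
-/

set_option autoImplicit false

noncomputable section

open scoped BigOperators
open MeasureTheory Set
open Literature.MathematicalPhysics.QuantumFieldTheory.Balaban1983to89
open Literature.MathematicalPhysics.QuantumFieldTheory.Balaban1983to89.T3ContinuumYM3Torus
open Literature.MathematicalPhysics.QuantumFieldTheory.Balaban1983to89.T3UnitScaleTilt
open Literature.MathematicalPhysics.QuantumFieldTheory.Balaban1983to89.T3UnitLawDensityEML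
open Literature.MathematicalPhysics.QuantumFieldTheory.Balaban1983to89.T3OrbitAverage
open Summit.QuantumFields.YangMills.Theorems.PoincareLipschitz.TwoSidedOfConcentration
  (exists_capped_infConvolution boxLinkDist_nonneg boxLinkDist_self boxLinkDist_comm boxLinkDist_triangle continuous_boxLinkDist
    boxLinkDist_gaugeAct boxLinkDist_congr_left boxLinkDist_le_linkDist gaugeAct_gaugeAct_inv dist1_plaqHol_iter_gaugeAct)
open Summit.QuantumFields.YangMills.Theorems.LocalInsertion.HistoryTailOfInsertion (measurable_flux measurableSet_localGood)
open Literature.MathematicalPhysics.QuantumFieldTheory.Balaban1983to89.T4PairDerivBridge (dist1_le_two_specialUnitaryGroup)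
open Summit.QuantumFields.YangMills.Theorems.LocalInsertion.WindowTailOfConcentration (beta_mul_coupling_sq mul_exp_neg_two_mul_lt_half)

namespace Summit.QuantumFields.YangMills.Theorems.LocalInsertion.WindowTailOfConcentrationBoxFit

/-! ## §1 The two box-fit conditions -/

/-- The K1 box of side `17·L^j` fits the torus twice as soon as `3 ≤ F.m + K − j` (`L ≥ 3`: `L^{F.m+K−j} ≥ 27 ≥ 17`).
[cite: Balaban1985UV3, (3) p.256] -/
theorem boxFit_of_depth (F : T3Family) {K j : ℕ} (h3 : 3 ≤ F.m + K - j) :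
    2 * (17 * F.L ^ j) ≤ (F.P K).sitesPerDir 0 := by
  have hL3 : 3 ≤ F.L := by obtain ⟨k, hk⟩ := F.hL.1; have := F.hL.2; omega
  have hN0 : (F.P K).sitesPerDir 0 = 2 * F.L ^ (F.m + K) := by simp [Params.sitesPerDir]
  rw [hN0]
  have hsplit : F.L ^ (F.m + K) = F.L ^ j * F.L ^ (F.m + K - j) := by rw [← pow_add]; congr 1; omega
  have h27 : 27 ≤ F.L ^ (F.m + K - j) :=
    calc 27 = 3 ^ 3 := by norm_num
      _ ≤ F.L ^ 3 := Nat.pow_le_pow_left hL3 3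
      _ ≤ F.L ^ (F.m + K - j) := Nat.pow_le_pow_right (by omega) h3
  rw [hsplit]
  nlinarith

/-- The K1 box of side `17·L^j` is below the confinement side `β_K = L^K/γ` as soon as `17γ ≤ L^{K−j}`. [cite: Balaban1985UV3, (3) p.256] -/
theorem boxBeta_of_coupling (F : T3Family) {γ : ℝ} (hγ : 0 < γ) {K j : ℕ} (hjK : j ≤ K) (h17 : 17 * γ ≤ (F.L : ℝ) ^ (K - j)) :
    ((17 * F.L ^ j : ℕ) : ℝ) ≤ (F.scheme ℰp γ).β K := by
  have hβK : (F.scheme ℰp γ).β K = (F.L : ℝ) ^ K / γ := by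
    show (γ * (F.P K).eps)⁻¹ = _
    have heps : (F.P K).eps = ((F.L : ℝ)⁻¹) ^ K := rfl
    rw [heps, mul_inv, inv_pow, inv_inv, div_eq_inv_mul]
  rw [hβK, le_div_iff₀ hγ]
  push_cast
  have hsplit : (F.L : ℝ) ^ K = (F.L : ℝ) ^ j * (F.L : ℝ) ^ (K - j) := by rw [← pow_add]; congr 1; omega
  have hLj : (0 : ℝ) ≤ (F.L : ℝ) ^ j := by positivity
  rw [hsplit]
  calc (17 : ℝ) * (F.L : ℝ) ^ j * γ = (F.L : ℝ) ^ j * (17 * γ) := by ring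
    _ ≤ (F.L : ℝ) ^ j * (F.L : ℝ) ^ (K - j) := mul_le_mul_of_nonneg_left h17 hLj

/-! ## §2 The window tail step under the box-fit conditions -/

/-- **THE WINDOW TAIL STEP UNDER THE TWO BOX-FIT CONDITIONS** — ✓`WindowTailOfConcentration.windowTail_step` with its side conditions
`j + 2 ≤ K`, `γ ≤ ½` replaced by EXACTLY what the proof uses: the K1 box of side `17·L^j` fits the torus twice (`2·17L^j ≤ 2L^{m+K}`) and is
below the confinement side (`17L^j ≤ β_K`), at any height `j ≤ K` (so also the two TOP heights `j ∈ {K−1, K}` when `3 ≤ F.m + K − j` and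
`17γ ≤ L^{K−j}`, see `boxFit_of_depth` / `boxBeta_of_coupling`).  `hK1 ∧ hK2 ∧ hMed ⇒ Gibbs_K(G(a,j) ∩ {n·g ≤ dist1(Ū^j(∂a))}) ≤
Cc·exp(−(cc/(1156(CL+1)²))·n²)` for `n ≥ 2(m + (CL+1)√(578Cc/cc))`.  Same proof (McShane capped at `n·g`, K1 twice, `β_K g² = L^j`).
[cite: Balaban1985UV3, (3) p.256 and (7) p.257] -/
theorem windowTail_step_of_boxFit (F : T3Family) {γ b₀ p₀ : ℝ} (hγ : 0 < γ)
    {K j : ℕ} (hjK : j ≤ K) (h2n : 2 * (17 * F.L ^ j) ≤ (F.P K).sitesPerDir 0) (hnβ : ((17 * F.L ^ j : ℕ) : ℝ) ≤ (F.scheme ℰp γ).β K)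
    (a : Plaq (F.P K) j) {Cc cc CL m : ℝ} (hCc : 0 ≤ Cc) (hcc : 0 < cc) (hCL : 0 ≤ CL)
    (hK1 : ∀ (n : ℕ), 1 ≤ n → (n : ℝ) ≤ (F.scheme ℰp γ).β K → 2 * n ≤ (F.P K).sitesPerDir 0 →
      ∀ (x₀ : Site (F.P K) 0) (f : GaugeField (F.P K) 0 (Matrix.specialUnitaryGroup (Fin 2) ℂ) → ℝ) (Λ : ℝ), 0 < Λ → Measurable f → GaugeField.GaugeInvariant f →
      (∀ U U' : GaugeField (F.P K) 0 (Matrix.specialUnitaryGroup (Fin 2) ℂ), (∀ b : PBond (F.P K) 0, (∀ k, (b.src k - x₀ k).val < n) → (∀ k, (b.tgt k - x₀ k).val < n) → U b = U' b) →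
        f U = f U') →
      (∀ U U' : GaugeField (F.P K) 0 (Matrix.specialUnitaryGroup (Fin 2) ℂ), |f U - f U'| ≤ Λ * Real.sqrt (∑ b : PBond (F.P K) 0, GaugeGroup.dist1 (U b * (U' b)⁻¹) ^ 2)) →
      ∀ r : ℝ, 0 ≤ r → (gibbsK F ℰp γ K).real {U | r ≤ f U - ∫ V, f V ∂(gibbsK F ℰp γ K)} ≤
        Cc * Real.exp (-(cc * (F.scheme ℰp γ).β K * r ^ 2 / ((n : ℝ) ^ 2 * Λ ^ 2))))
    (hK2 : ∀ U U' : GaugeField (F.P K) 0 (Matrix.specialUnitaryGroup (Fin 2) ℂ), (∀ (i : ℕ) (q : Plaq (F.P K) i), i < j → Site.tdist (fun k => ((((q.src k).val * F.L ^ i : ℕ)) : ZMod ((F.P K).sitesPerDir 0))) (fun k => ((((a.src k).val * F.L ^ j : ℕ)) : ZMod ((F.P K).sitesPerDir 0))) + 64 * F.L ^ i ≤ 64 * F.L ^ j → GaugeGroup.dist1 (GaugeField.plaqHol (Averaging.iter (fun i' => BlockAveraging.blockAvg (P := F.P K) (j := i') ℰp) i U) q) < θBal F.L γ b₀ p₀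 (K - i)) → (∀ (i : ℕ) (q : Plaq (F.P K) i), i < j → Site.tdist (fun k => ((((q.src k).val * F.L ^ i : ℕ)) : ZMod ((F.P K).sitesPerDir 0))) (fun k => ((((a.src k).val * F.L ^ j : ℕ)) : ZMod ((F.P K).sitesPerDir 0))) + 64 * F.L ^ i ≤ 64 * F.L ^ j → GaugeGroup.dist1 (GaugeField.plaqHol (Averaging.iter (fun i' => BlockAveraging.blockAvg (P := F.P K) (j := i') ℰp) i U') q) < θBal F.L γ b₀ p₀ (K - i)) →
      |GaugeGroup.dist1 (GaugeField.plaqHol (Averaging.iter (fun i' => BlockAveraging.blockAvg (P := F.P K) (j := i') ℰp) j U) a) - GaugeGroup.dist1 (GaugeField.plaqHol (Averaging.iter (fun i' => BlockAveraging.blockAvg (P := F.P K) (j := i') ℰp) j U') a)| ≤ CL / Real.sqrt ((F.L : ℝ) ^ j) * Real.sqrt (∑ b : PBond (F.P K) 0, if (∀ k, (b.src k - ((((a.src k).val * F.L ^ j : ℕ)) : ZMod ((F.P K).sitesPerDir 0)) + ((8 * F.L ^ j : ℕ) : ZMod ((F.P K).sitesPerDir 0))).val < 17 * F.L ^ j)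 ∧ (∀ k, (b.tgt k - ((((a.src k).val * F.L ^ j : ℕ)) : ZMod ((F.P K).sitesPerDir 0)) + ((8 * F.L ^ j : ℕ) : ZMod ((F.P K).sitesPerDir 0))).val < 17 * F.L ^ j) then GaugeGroup.dist1 (U b * (U' b)⁻¹) ^ 2 else 0))
    (hMed : 1 / 2 ≤ (gibbsK F ℰp γ K).real ({U : GaugeField (F.P K) 0 (Matrix.specialUnitaryGroup (Fin 2) ℂ) | (∀ (i : ℕ) (q : Plaq (F.P K) i), i < j → Site.tdist (fun k => ((((q.src k).val * F.L ^ i : ℕ)) : ZMod ((F.P K).sitesPerDir 0))) (fun k => ((((a.src k).val * F.L ^ j : ℕ)) : ZMod ((F.P K).sitesPerDir 0))) + 64 * F.L ^ i ≤ 64 * F.L ^ j → GaugeGroup.dist1 (GaugeField.plaqHol (Averaging.iter (fun i' => BlockAveraging.blockAvg (P := F.P K) (j := i') ℰp) i U) q) < θBal F.L γ b₀ p₀ (K - i))} ∩ {U | GaugeGroup.dist1 (GaugeField.plaqHol (Averaging.iter (fun i' => BlockAveraging.blockAvg (P := F.P K) (j := i') ℰp) j U) a) ≤ m * Real.sqrt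 (γ * ((F.L : ℝ)⁻¹) ^ (K - j))}))
    (n : ℕ) (hn : 2 * (m + (CL + 1) * Real.sqrt (578 * Cc / cc)) ≤ (n : ℝ)) :
    (gibbsK F ℰp γ K).real ({U : GaugeField (F.P K) 0 (Matrix.specialUnitaryGroup (Fin 2) ℂ) | (∀ (i : ℕ) (q : Plaq (F.P K) i), i < j → Site.tdist (fun k => ((((q.src k).val * F.L ^ i : ℕ)) : ZMod ((F.P K).sitesPerDir 0))) (fun k => ((((a.src k).val * F.L ^ j : ℕ)) : ZMod ((F.P K).sitesPerDir 0))) + 64 * F.L ^ i ≤ 64 * F.L ^ j → GaugeGroup.dist1 (GaugeField.plaqHol (Averaging.iter (fun i' => BlockAveraging.blockAvg (P := F.P K) (j := i') ℰp) i U) q) < θBal F.L γ b₀ p₀ (K - i))} ∩ {U | (n : ℝ) * Real.sqrt (γ * ((F.L : ℝ)⁻¹) ^ (K - j)) ≤ GaugeGroup.dist1 (GaugeField.plaqHol (Averaging.iter (fun i' => BlockAveraging.blockAvg (P := F.P K) (j := i') ℰp) j U) a)}) ≤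
      Cc * Real.exp (-(cc / (1156 * (CL + 1) ^ 2) * (n : ℝ) ^ 2)) := by
  haveI := isProbabilityMeasure_gibbsK F ℰp hγ.le K
  have hL1 : 1 ≤ F.L := F.hL.2.le
  set μ := gibbsK F ℰp γ K with hμ
  set gK := Real.sqrt (γ * ((F.L : ℝ)⁻¹) ^ (K - j)) with hgK
  have hgpos : 0 < gK :=
    Real.sqrt_pos.2 (mul_pos hγ (pow_pos (inv_pos.2 (by exact_mod_cast lt_trans zero_lt_one F.hL.2)) _))
  have hLj : (0 : ℝ) < (F.L : ℝ) ^ j := by positivity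
  have hsq : 0 < Real.sqrt ((F.L : ℝ) ^ j) := Real.sqrt_pos.mpr hLj
  set Λ : ℝ := (CL + 1) / Real.sqrt ((F.L : ℝ) ^ j) with hΛ
  have hΛpos : 0 < Λ := div_pos (by linarith) hsq
  set r₀ : ℝ := (CL + 1) * Real.sqrt (578 * Cc / cc) with hr₀
  have hr₀0 : 0 ≤ r₀ := mul_nonneg (by linarith) (Real.sqrt_nonneg _)
  set θn : ℝ := (n : ℝ) * gK with hθn
  have hθn0 : 0 ≤ θn := mul_nonneg (Nat.cast_nonneg n) hgpos.le
  set f : GaugeField (F.P K) 0 (Matrix.specialUnitaryGroup (Fin 2) ℂ) → ℝ := fun U => GaugeGroup.dist1 (GaugeField.plaqHol (Averaging.iter (fun i' => BlockAveraging.blockAvg (P := F.P K) (j := i') ℰp) j U) a) with hf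
  set G : Set (GaugeField (F.P K) 0 (Matrix.specialUnitaryGroup (Fin 2) ℂ)) := {U : GaugeField (F.P K) 0 (Matrix.specialUnitaryGroup (Fin 2) ℂ) | (∀ (i : ℕ) (q : Plaq (F.P K) i), i < j → Site.tdist (fun k => ((((q.src k).val * F.L ^ i : ℕ)) : ZMod ((F.P K).sitesPerDir 0))) (fun k => ((((a.src k).val * F.L ^ j : ℕ)) : ZMod ((F.P K).sitesPerDir 0))) + 64 * F.L ^ i ≤ 64 * F.L ^ j → GaugeGroup.dist1 (GaugeField.plaqHol (Averaging.iter (fun i' => BlockAveraging.blockAvg (P := F.P K) (j := i') ℰp) i U) q) < θBal F.L γ b₀ p₀ (K - i))} with hG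
  set d : GaugeField (F.P K) 0 (Matrix.specialUnitaryGroup (Fin 2) ℂ) → GaugeField (F.P K) 0 (Matrix.specialUnitaryGroup (Fin 2) ℂ) → ℝ := fun U U' => Real.sqrt (∑ b : PBond (F.P K) 0, if (∀ k, (b.src k - ((((a.src k).val * F.L ^ j : ℕ)) : ZMod ((F.P K).sitesPerDir 0)) + ((8 * F.L ^ j : ℕ) : ZMod ((F.P K).sitesPerDir 0))).val < 17 * F.L ^ j) ∧ (∀ k, (b.tgt k - ((((a.src k).val * F.L ^ j : ℕ)) : ZMod ((F.P K).sitesPerDir 0)) + ((8 * F.L ^ j : ℕ) : ZMod ((F.P K).sitesPerDir 0))).val < 17 * F.L ^ j) then GaugeGroup.dist1 (U b * (U' b)⁻¹) ^ 2 else 0) with hd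
  -- §a the McShane extension capped at `θn = n·g`
  obtain ⟨gn, hg0, hgθ, hgf, hgeq, hgLip, hginv, hgloc, hgmeas⟩ :=
    exists_capped_infConvolution d (fun U U' => boxLinkDist_nonneg _ U U') (fun U => boxLinkDist_self _ U)
      (fun U U' => boxLinkDist_comm _ U U') (fun U U' U'' => boxLinkDist_triangle _ U U' U'')
      (fun U' => continuous_boxLinkDist _ U') G f (fun U => GaugeGroup.dist1_nonneg _) θn Λ hθn0 hΛpos.le
      (fun U hU U' hU' => (hK2 U U' hU hU').trans
        (mul_le_mul_of_nonneg_right (div_le_div_of_nonneg_right (by linarith) hsq.le) (Real.sqrt_nonneg _)))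
      (GaugeField.gaugeAct (P := F.P K) (j := 0) (G := (Matrix.specialUnitaryGroup (Fin 2) ℂ)))
      (fun u U hU => by
        simp only [hG, Set.mem_setOf_eq] at hU ⊢
        intro i q hi hnear
        rw [dist1_plaqHol_iter_gaugeAct F (by omega) q u U]
        exact hU i q hi hnear)
      (fun u U => by simp only [hf]; exact dist1_plaqHol_iter_gaugeAct F (by omega) a u U)
      (fun u U U' => boxLinkDist_gaugeAct _ u U U')
      (fun u => ⟨fun x => (u x)⁻¹, gaugeAct_gaugeAct_inv u⟩)
      (fun U U' => ∀ b : PBond (F.P K) 0, (∀ k, (b.src k - ((((a.src k).val * F.L ^ j : ℕ)) : ZMod ((F.P K).sitesPerDir 0)) + ((8 * F.L ^ j : ℕ) : ZMod ((F.P K).sitesPerDir 0))).val < 17 * F.L ^ j) ∧ (∀ k, (b.tgt k - ((((a.src k).val * F.L ^ j : ℕ)) : ZMod ((F.P K).sitesPerDir 0)) + ((8 * F.L ^ j : ℕ) : ZMod ((F.P K).sitesPerDir 0))).val < 17 * F.L ^ j) → U b = U' b)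
      (fun U U' h V => boxLinkDist_congr_left _ h V)
  have hgn_int : Integrable gn μ :=
    Integrable.mono' (integrable_const θn) hgmeas.aestronglyMeasurable
      (ae_of_all _ fun U => by rw [Real.norm_eq_abs, abs_of_nonneg (hg0 U)]; exact hgθ U)
  set E : ℝ := ∫ V, gn V ∂μ with hE
  -- §b the box: side `17 L^j`, corner `corner(a) L^j − 8 L^j`
  have h1n : 1 ≤ 17 * F.L ^ j := by
    have : 1 ≤ F.L ^ j := Nat.one_le_pow _ _ (by omega)
    omega
  set x₀ : Site (F.P K) 0 := fun k => ((((a.src k).val * F.L ^ j : ℕ)) : ZMod ((F.P K).sitesPerDir 0)) - ((8 * F.L ^ j : ℕ) : ZMod ((F.P K).sitesPerDir 0)) with hx₀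
  have hbox : ∀ U U' : GaugeField (F.P K) 0 (Matrix.specialUnitaryGroup (Fin 2) ℂ), (∀ b : PBond (F.P K) 0, (∀ k, (b.src k - x₀ k).val < 17 * F.L ^ j) →
      (∀ k, (b.tgt k - x₀ k).val < 17 * F.L ^ j) → U b = U' b) → gn U = gn U' := by
    intro U U' h
    refine hgloc U U' fun b hb => h b (fun k => ?_) (fun k => ?_)
    · have hk : b.src k - x₀ k = b.src k - ((((a.src k).val * F.L ^ j : ℕ)) : ZMod ((F.P K).sitesPerDir 0)) + ((8 * F.L ^ j : ℕ) : ZMod ((F.P K).sitesPerDir 0)) := by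
        simp only [hx₀]; ring
      rw [hk]; exact hb.1 k
    · have hk : b.tgt k - x₀ k = b.tgt k - ((((a.src k).val * F.L ^ j : ℕ)) : ZMod ((F.P K).sitesPerDir 0)) + ((8 * F.L ^ j : ℕ) : ZMod ((F.P K).sitesPerDir 0)) := by
        simp only [hx₀]; ring
      rw [hk]; exact hb.2 k
  have hLipg : ∀ U U' : GaugeField (F.P K) 0 (Matrix.specialUnitaryGroup (Fin 2) ℂ), |gn U - gn U'| ≤
      Λ * Real.sqrt (∑ b : PBond (F.P K) 0, GaugeGroup.dist1 (U b * (U' b)⁻¹) ^ 2) :=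
    fun U U' => (hgLip U U').trans (mul_le_mul_of_nonneg_left (boxLinkDist_le_linkDist _ U U') hΛpos.le)
  -- the same data for `−gn`
  have hbox' : ∀ U U' : GaugeField (F.P K) 0 (Matrix.specialUnitaryGroup (Fin 2) ℂ), (∀ b : PBond (F.P K) 0, (∀ k, (b.src k - x₀ k).val < 17 * F.L ^ j) →
      (∀ k, (b.tgt k - x₀ k).val < 17 * F.L ^ j) → U b = U' b) → (fun V => -gn V) U = (fun V => -gn V) U' :=
    fun U U' h => by simp only [hbox U U' h]
  have hLipg' : ∀ U U' : GaugeField (F.P K) 0 (Matrix.specialUnitaryGroup (Fin 2) ℂ), |(fun V => -gn V) U - (fun V => -gn V) U'| ≤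
      Λ * Real.sqrt (∑ b : PBond (F.P K) 0, GaugeGroup.dist1 (U b * (U' b)⁻¹) ^ 2) := by
    intro U U'
    have h := hLipg U U'
    rwa [show (fun V => -gn V) U - (fun V => -gn V) U' = -(gn U - gn U') by ring, abs_neg]
  have hginv' : GaugeField.GaugeInvariant (fun V => -gn V) := fun u U => by simp only [hginv u U]
  -- §c the exponent: `cc β_K (s g)² / ((17L^j)² Λ²) = (cc/(289 (CL+1)²)) s²`
  have hβg : (F.scheme ℰp γ).β K * gK ^ 2 = (F.L : ℝ) ^ j := beta_mul_coupling_sq F hγ (by omega)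
  have hnΛ : (((17 * F.L ^ j : ℕ)) : ℝ) ^ 2 * Λ ^ 2 = 289 * (CL + 1) ^ 2 * (F.L : ℝ) ^ j := by
    rw [hΛ, div_pow, Real.sq_sqrt hLj.le]
    push_cast
    field_simp
    ring
  have hCL1 : (CL + 1) ≠ 0 := by linarith
  have hexp : ∀ s : ℝ, cc * (F.scheme ℰp γ).β K * (s * gK) ^ 2 / ((((17 * F.L ^ j : ℕ)) : ℝ) ^ 2 * Λ ^ 2) =
      cc / (289 * (CL + 1) ^ 2) * s ^ 2 := by
    intro s
    have h1 : cc * (F.scheme ℰp γ).β K * (s * gK) ^ 2 = cc * s ^ 2 * ((F.scheme ℰp γ).β K * gK ^ 2) := by ring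
    rw [h1, hβg, hnΛ]
    field_simp
  -- §d the mean of `gn` from the median row and the LOWER tail
  have hEle : E ≤ (m + r₀) * gK := by
    by_contra H
    push Not at H
    have hK := hK1 (17 * F.L ^ j) h1n hnβ h2n x₀ (fun V => -gn V) Λ hΛpos hgmeas.neg hginv' hbox' hLipg' (r₀ * gK)
      (mul_nonneg hr₀0 hgpos.le)
    rw [hexp r₀] at hK
    have hEneg : ∫ V, (fun V => -gn V) V ∂μ = -E := by simp only [hE]; exact integral_neg gn
    rw [hEneg] at hK
    have hsub : G ∩ {U : GaugeField (F.P K) 0 (Matrix.specialUnitaryGroup (Fin 2) ℂ) | f U ≤ m * gK} ⊆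
        {U | r₀ * gK ≤ (fun V => -gn V) U - -E} := by
      rintro U ⟨hUG, hUf⟩
      simp only [Set.mem_setOf_eq] at hUf ⊢
      have h1 : gn U ≤ f U := hgf U hUG
      have h2 : (m + r₀) * gK = m * gK + r₀ * gK := by ring
      linarith
    have hr₀sq : cc / (289 * (CL + 1) ^ 2) * r₀ ^ 2 = 2 * Cc := by
      rw [hr₀, mul_pow, Real.sq_sqrt (by positivity)]
      field_simp
      ring
    rw [hr₀sq] at hK
    have hchain : (1 : ℝ) / 2 ≤ Cc * Real.exp (-(2 * Cc)) :=
      calc (1 : ℝ) / 2 ≤ μ.real (G ∩ {U | f U ≤ m * gK}) := hMed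
        _ ≤ μ.real {U | r₀ * gK ≤ (fun V => -gn V) U - -E} := measureReal_mono hsub (measure_ne_top _ _)
        _ ≤ Cc * Real.exp (-(2 * Cc)) := hK
    linarith [mul_exp_neg_two_mul_lt_half Cc]
  -- §e the UPPER tail at `s = n/2`
  have hsub : G ∩ {U : GaugeField (F.P K) 0 (Matrix.specialUnitaryGroup (Fin 2) ℂ) | θn ≤ f U} ⊆ {U | (n : ℝ) / 2 * gK ≤ gn U - E} := by
    rintro U ⟨hUG, hUf⟩
    simp only [Set.mem_setOf_eq] at hUf ⊢
    rw [hgeq U hUG hUf, hθn]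
    have h1 : 2 * (m + r₀) * gK ≤ (n : ℝ) * gK := mul_le_mul_of_nonneg_right hn hgpos.le
    have h2 : 2 * (m + r₀) * gK = 2 * ((m + r₀) * gK) := by ring
    have h3 : (n : ℝ) / 2 * gK = (n : ℝ) * gK / 2 := by ring
    rw [h3]
    linarith
  have hK := hK1 (17 * F.L ^ j) h1n hnβ h2n x₀ gn Λ hΛpos hgmeas hginv hbox hLipg ((n : ℝ) / 2 * gK) (by positivity)
  rw [hexp ((n : ℝ) / 2)] at hK
  have hcoef : cc / (289 * (CL + 1) ^ 2) * ((n : ℝ) / 2) ^ 2 = cc / (1156 * (CL + 1) ^ 2) * (n : ℝ) ^ 2 := by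
    field_simp; ring
  rw [hcoef] at hK
  have hset : ({U : GaugeField (F.P K) 0 (Matrix.specialUnitaryGroup (Fin 2) ℂ) | (∀ (i : ℕ) (q : Plaq (F.P K) i), i < j → Site.tdist (fun k => ((((q.src k).val * F.L ^ i : ℕ)) : ZMod ((F.P K).sitesPerDir 0))) (fun k => ((((a.src k).val * F.L ^ j : ℕ)) : ZMod ((F.P K).sitesPerDir 0))) + 64 * F.L ^ i ≤ 64 * F.L ^ j → GaugeGroup.dist1 (GaugeField.plaqHol (Averaging.iter (fun i' => BlockAveraging.blockAvg (P := F.P K) (j := i') ℰp) i U) q) < θBal F.L γ b₀ p₀ (K - i))} ∩ {U | (n : ℝ) * Real.sqrt (γ * ((F.L : ℝ)⁻¹) ^ (K - j)) ≤ GaugeGroup.dist1 (GaugeField.plaqHol (Averaging.iter (fun i' => BlockAveraging.blockAvg (P := F.P K) (j := i') ℰp) j U) a)}) = G ∩ {U | θn ≤ f U} := by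
    simp only [hG, hθn, hf, hgK]
  calc μ.real ({U : GaugeField (F.P K) 0 (Matrix.specialUnitaryGroup (Fin 2) ℂ) | (∀ (i : ℕ) (q : Plaq (F.P K) i), i < j → Site.tdist (fun k => ((((q.src k).val * F.L ^ i : ℕ)) : ZMod ((F.P K).sitesPerDir 0))) (fun k => ((((a.src k).val * F.L ^ j : ℕ)) : ZMod ((F.P K).sitesPerDir 0))) + 64 * F.L ^ i ≤ 64 * F.L ^ j → GaugeGroup.dist1 (GaugeField.plaqHol (Averaging.iter (fun i' => BlockAveraging.blockAvg (P := F.P K) (j := i') ℰp) i U) q) < θBal F.L γ b₀ p₀ (K - i))} ∩ {U | (n : ℝ) * Real.sqrt (γ * ((F.L : ℝ)⁻¹) ^ (K - j)) ≤ GaugeGroup.dist1 (GaugeField.plaqHol (Averaging.iter (fun i' => BlockAveraging.blockAvg (P := F.P K) (j := i') ℰp) j U) a)})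
      = μ.real (G ∩ {U | θn ≤ f U}) := by rw [hset]
    _ ≤ μ.real {U | (n : ℝ) / 2 * gK ≤ gn U - E} := measureReal_mono hsub (measure_ne_top _ _)
    _ ≤ Cc * Real.exp (-(cc / (1156 * (CL + 1) ^ 2) * (n : ℝ) ^ 2)) := hK

end Summit.QuantumFields.YangMills.Theorems.LocalInsertion.WindowTailOfConcentrationBoxFit
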